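import Literature.Geometry.Kaehler.ComplexTorusCyclotomicAutomorphismSimplePrimeDimension
import Literature.AlgebraicGeometry.ComplexMultiplication.CyclotomicCMTypeCensusEleven
import Literature.NumberTheory.NumberFields.CyclotomicFieldElevenClassNumber
import HarnessLib

/-!
# Complex tori of dimension `5` with an automorphism of order `11`: EXACTLY FOUR — three simple `ζ₁₁`-fivefolds (one for
# each family of primitive CM types of `ℚ(ζ₁₁)`) and one non-simple torus `∼ E⁵` (`E` a CM elliptic curve of `ℚ(√−11)`)

Layer `Literature/Geometry/Kaehler`, namespace `Literature.Geometry.Kaehler.ComplexTorus`; lane `lit-hodgefound`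
(Track 2 foundations library), Layer A2/A3 junction, row «A2-26(gm)» (self-proposed 2026-08-28, prover seat
`lit-hodgefound-p10`, generation 32, FILE 11 of the generation).  Theorems only; no `def`, no instance, no named fact
(net Literature debt 0).

An endomorphism `u` of order `11` of a `5`-dimensional complex torus `X` has `P_u = Φ₁₁` (generation 31 FILE 2: prime
order, `rk = 10 = φ(11)`), so `(X, u) ≅ (ℂ⁵/Φ(𝔞), ζ₁₁)` for a CM type `Φ` of `K = ℚ(ζ₁₁)` and an ideal class `[𝔞]`
(FILE 1, Shimura's THEOREM 2); `h(ℚ(ζ₁₁)) = 1` (generation 32 FILE 9, `CyclotomicFieldElevenClassNumber`), so `𝔞 = 𝓞`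
throughout, and the isomorphism class of `X` is the FAMILY of `Φ` (generation 31: `isIsomorphic_iff_isAutTransform` for
simple `X`).  The census of `ℚ(ζ₁₁)` (generation 32 FILE 10, `CyclotomicCMTypeCensusEleven`): `32` types, `30` primitive
ones in THREE families, `2` imprimitive ones (induced from `K₀ = ℚ(√−11)`, the fourth family).  Hence:

* §0 (any CM field of degree `2p`, `p` prime) `finrank_eq_two_of_ne_top_of_finrank_eq_two_mul_prime`,
  **`exists_isIsogenous_pow_of_not_isSimple`**: a non-simple `ℂ^p/Φ(𝔞)` is isogenous to `E^p`, `E = ℂ/Φ₀(𝔞₀)` a CM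
  elliptic curve of the imaginary quadratic subfield inducing `Φ` (generation 32 FILE 4 did `2p = 6`).
* §1 THE MODELS OF `ℚ(ζ₁₁)`: `finrank_eq_ten_of_isCyclotomicExtension_eleven`,
  `exists_isIsogenous_pow_five_periodIso_eleven`, **`isIsomorphic_periodIso_iff_isAutTransform_eleven`** (simple
  models, ALL ideals, no hypothesis: `ℂ⁵/Φ(𝔞) ≅ ℂ⁵/Ψ(𝔟) ⟺ Φ ~ Ψ`), `isIsomorphic_periodIso_iff_of_not_isSimple_eleven` (the
  non-simple models are ONE torus), **`exists_four_models_eleven`** (four pairwise non-isomorphic models `ℂ⁵/Φᵢ(𝓞)`,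
  three simple and one not, to one of which every `ℂ⁵/Φ(𝔞)` is isomorphic).
* §2 THE PAIRS `(X, u)`, `orderOf u = 11`, `dim X = 5`: `exists_isIsogenous_pow_five_of_orderOf_eq_eleven`
  (non-simple `X ∼ E⁵`), `isIsomorphic_of_not_isSimple_of_orderOf_eq_eleven` (ONE non-simple torus),
  **`exists_four_forall_isIsomorphic_of_orderOf_eq_eleven`** — EXACTLY FOUR complex tori of dimension `5` admit an
  automorphism of order `11` —, and the Hodge side for ALL of them: **`divisorClasses_powPeriod_eq_hodgeClasses_of_orderOf_eq_eleven`**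
  (`Hdg(X^k) = Div(X^k)` for all `k`; simple: generation 32 FILE 8; non-simple: `X ∼ E⁵`, isogeny invariance and
  Moonen–Zarhin for the CM elliptic curve `E`).
* §3 Order `22` (`−u` has order `11`, FILE 8): the same classification for endomorphisms of order `11` or `22`.

## References

* [Shimura1998] G. Shimura, *Abelian Varieties with Complex Multiplication and Modular Functions* (1998), §6.1
  Thm. 2 p. 41, §6.2 Thm. 3 pp. 42–44, §7.4 Prop. 17 p. 58, §8.2 Prop. 26 p. 69, §8.4 Example (1) p. 65 (p0085).
* [BirkenhakeLange2004] Ch. Birkenhake, H. Lange, *Complex Abelian Varieties*, 2nd ed. (2004), §13.3.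
* [Washington1997] L. C. Washington, *Introduction to Cyclotomic Fields*, 2nd ed. (1997), Thm. 11.1.
* [MoonenZarhin1999LowDim] B. Moonen, Yu. Zarhin, *Hodge classes on abelian varieties of low dimension* (1999),
  Thm. 0.1 (4), (0.2)(4).
* [Streng2010] M. Streng, *Complex multiplication of abelian surfaces*, PhD thesis, Leiden (2010), Ch. I Lemma 3.5.
-/

noncomputable section

open scoped Classical nonZeroDivisors NumberField Manifold ContDiff MatrixGroups
open NumberField Module Polynomial

namespace Literature.Geometry.Kaehler

namespace ComplexTorus

-- `open scoped`: the tree's action of `Aut(ℂ)` on `Hom(K, ℂ)` by composition (`ringEquivCompAction`) is a scoped instance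
open scoped Literature.NumberTheory.ComplexMultiplication
open Literature.NumberTheory.Automorphic (IsTorusSubgroup)
open Literature.AlgebraicGeometry.Motives (CMType HodgeTensorFacts hodgeTensorFacts_holds)
open Literature.NumberTheory.ComplexMultiplication (inducedCMType)
open Literature.NumberTheory.ComplexMultiplication.CMTypeLattice (periodIso basisIndex card_basisIndex_eq_finrank
  isSimple_periodIso_iff_isPrimitive isSimple_periodIso_iff_not_exists_inducedCMType isIsogenous_powPeriod_periodIso_of_basis
  two_mul_card_eq_finrank isAbelianVariety_periodIso isTotallyComplex_of_cmType)
open Literature.NumberTheory.ComplexMultiplication (CMTypeLattice.isSimple_periodIso_of_finrank_eq_two)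
open Literature.AlgebraicGeometry.ComplexMultiplication.CyclotomicCMTypeResidueSets (IsAutTransform)
open Literature.AlgebraicGeometry.ComplexMultiplication.CyclotomicCMTypeCensusEleven (exists_three_families_eleven
  ncard_isPrimitive_and_not_eleven isAutTransform_iff_not_isPrimitive_eleven)
open Literature.NumberTheory.NumberFields (classNumber_eq_one_of_isCyclotomicExtension_eleven
  isPrincipalIdealRing_ringOfIntegers_cyclotomicField_eleven)
-- `CMTypeLattice.mulMatrix I a` is spelled with its namespace below (the elliptic files declare `ComplexTorus.mulMatrix`).
open Literature.NumberTheory.ComplexMultiplication (CMTypeLattice.mulMatrix)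

/-! ### §0 Degree `2p` generalities: a non-simple `ℂ^p/Φ(𝔞)` is isogenous to the `p`-th power of a CM elliptic curve -/

section TwoMulPrime

variable {K : Type} [Field K] [NumberField K] {p : ℕ}

/-- **A proper sub-pair of a CM field of degree `2p` (`p` prime) is imaginary quadratic with `[K : K₀] = p`**: if a CM
type of a number field `K` of degree `2p` is induced from a CM type `Φ₀` of a proper subfield `K₀ ⊊ K`, then `[K₀ : ℚ] = 2`
and `[K : K₀] = p` (`[K₀ : ℚ] = 2#Φ₀`, `#Φ₀ · [K : K₀] = p`, `[K : K₀] ≠ 1`). [cite: Shimura1998, §6.2, proof of Thm. 3 («`n = mh`»), p. 42]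
[cite: Streng2010, Ch. I Lemma 3.5] -/
theorem finrank_eq_two_of_ne_top_of_finrank_eq_two_mul_prime (hp : p.Prime) (h2p : finrank ℚ K = 2 * p)
    {K₀ : IntermediateField ℚ K} (hK₀ : K₀ ≠ ⊤) (Φ₀ : CMType K₀) : finrank ℚ K₀ = 2 ∧ finrank K₀ K = p := by
  have hmul : finrank ℚ K₀ * finrank K₀ K = 2 * p := by rw [Module.finrank_mul_finrank, h2p]
  have hne : finrank K₀ K ≠ 1 := fun h1 ↦ hK₀ (IntermediateField.finrank_eq_one_iff_eq_top.1 h1)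
  have h2c := two_mul_card_eq_finrank Φ₀
  -- `#Φ₀ · [K : K₀] = p`
  have hce : Fintype.card Φ₀.1 * finrank K₀ K = p := by
    have h : 2 * (Fintype.card Φ₀.1 * finrank K₀ K) = 2 * p := by rw [← mul_assoc, h2c, hmul]
    omega
  have hdvd : finrank K₀ K ∣ p := Dvd.intro_left _ hce
  rcases (Nat.dvd_prime hp).1 hdvd with h1 | he
  · exact absurd h1 hne
  · refine ⟨?_, he⟩
    rw [he] at hce
    have hc : Fintype.card Φ₀.1 = 1 := Nat.eq_of_mul_eq_mul_right hp.pos (by rw [one_mul]; exact hce)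
    omega

/-- **A NON-SIMPLE CM torus `ℂ^p/Φ(𝔞)` of a field of degree `2p` (`p` prime) is isogenous to `E^p`**: `Φ` is induced
from a CM type `Φ₀` of an imaginary quadratic subfield `K₀` (Prop. 26), and `ℂ^p/Φ(𝔞) ∼ (ℂ/Φ₀(𝔞₀))^p` for EVERY fractional
ideal `𝔞₀` of `K₀` (Thm. 3 at torus level), the curves `ℂ/Φ₀(𝔞₀)` being simple.
[cite: Shimura1998, §8.2 Prop. 26 p. 69 with §6.2 Thm. 3 pp. 42–44] [cite: Streng2010, Ch. I Lemma 3.5] -/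
theorem exists_isIsogenous_pow_of_not_isSimple (hp : p.Prime) (h2p : finrank ℚ K = 2 * p) (Φ : CMType K)
    (I : (FractionalIdeal (𝓞 K)⁰ K)ˣ) (hns : ¬ ComplexTorus.IsSimple (periodIso Φ I)) :
    ∃ (K₀ : IntermediateField ℚ K) (Φ₀ : CMType K₀),
      finrank ℚ K₀ = 2 ∧ inducedCMType (algebraMap K₀ K) Φ₀ = Φ ∧
      ∀ I₀ : (FractionalIdeal (𝓞 K₀)⁰ K₀)ˣ,
        ComplexTorus.IsSimple (periodIso Φ₀ I₀) ∧ IsIsogenous (periodIso Φ I) (powPeriod (periodIso Φ₀ I₀) p) := by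
  rw [isSimple_periodIso_iff_not_exists_inducedCMType Φ I, not_not] at hns
  obtain ⟨K₀, Φ₀, hK₀, hΦ⟩ := hns
  obtain ⟨h2, hrel⟩ := finrank_eq_two_of_ne_top_of_finrank_eq_two_mul_prime hp h2p hK₀ Φ₀
  refine ⟨K₀, Φ₀, h2, hΦ, fun I₀ ↦ ⟨CMTypeLattice.isSimple_periodIso_of_finrank_eq_two h2 Φ₀ I₀, ?_⟩⟩
  exact ComplexTorus.IsIsogenous.symm _ _
    (isIsogenous_powPeriod_periodIso_of_basis hΦ (Module.finBasisOfFinrankEq K₀ K hrel) I I₀)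

end TwoMulPrime

/-! ### §1 The models `ℂ⁵/Φ(𝔞)` of `ℚ(ζ₁₁)` -/

section Models

variable {K : Type} [Field K] [NumberField K] [IsCyclotomicExtension {11} ℚ K]

variable (K) in
/-- **`[ℚ(ζ₁₁) : ℚ] = φ(11) = 10`.** [cite: Washington1997, Thm. 2.5] [folklore] -/
theorem finrank_eq_ten_of_isCyclotomicExtension_eleven : finrank ℚ K = 10 := by
  rw [IsCyclotomicExtension.Rat.finrank 11 K]
  decide

omit [IsCyclotomicExtension {11} ℚ K] in
/-- A number field has a complex embedding (to read primitivity at). [folklore] -/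
private theorem nonempty_embedding₁₁ : Nonempty (K →+* ℂ) := inferInstance

variable (K) in
/-- `𝓞_K` is principal: `h(ℚ(ζ₁₁)) = 1` (generation 32 FILE 9). [cite: Washington1997, Thm. 11.1] -/
private theorem isPrincipalIdealRing_eleven : IsPrincipalIdealRing (𝓞 K) :=
  (classNumber_eq_one_iff (K := K)).1 (classNumber_eq_one_of_isCyclotomicExtension_eleven K inferInstance)

/-- `dim_ℂ ℂ^Φ = 5` for a CM type `Φ` of `ℚ(ζ₁₁)`. [cite: Shimura1998, §6.2 Thm. 3, p. 42] -/
private theorem finrank_pi_cmType_eleven (Φ : CMType K) : finrank ℂ (Φ.1 → ℂ) = 5 := by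
  have h := two_mul_finrank_pi_cmType (d := 11) (K := K) Φ
  rw [Nat.totient_prime Nat.prime_eleven] at h
  omega

/-- Both kinds occur for `ℚ(ζ₁₁)`: there is a simple `ℂ⁵/Φ(𝔞)` (thirty of the `32` types are primitive) and a non-simple
`ℂ⁵/Ψ(𝔞)` (the two imprimitive types); the counts are the census's `ncard_isPrimitive_and_not_eleven`.
[cite: Shimura1998, §8.4 Example (1) p. 65, §8.2 Prop. 26 p. 69] -/
private theorem exists_isSimple_and_not_isSimple_periodIso_eleven (I : (FractionalIdeal (𝓞 K)⁰ K)ˣ) :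
    ∃ Φ Ψ : CMType K, ComplexTorus.IsSimple (periodIso Φ I) ∧ ¬ ComplexTorus.IsSimple (periodIso Ψ I) := by
  obtain ⟨φ₀⟩ := nonempty_embedding₁₁ (K := K)
  obtain ⟨hp, hn⟩ := ncard_isPrimitive_and_not_eleven (L := K) φ₀
  have hne : {Φ : CMType K | Literature.NumberTheory.ComplexMultiplication.IsPrimitive (ℂ ≃+* ℂ) Φ.1 φ₀}.Nonempty :=
    Set.nonempty_of_ncard_ne_zero (by rw [hp]; norm_num)
  have hne' : {Φ : CMType K | ¬ Literature.NumberTheory.ComplexMultiplication.IsPrimitive (ℂ ≃+* ℂ) Φ.1 φ₀}.Nonempty :=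
    Set.nonempty_of_ncard_ne_zero (by rw [hn]; norm_num)
  obtain ⟨Φ, hΦ⟩ := hne
  obtain ⟨Ψ, hΨ⟩ := hne'
  exact ⟨Φ, Ψ, (isSimple_periodIso_iff_isPrimitive Φ I φ₀).2 hΦ,
    fun h ↦ hΨ ((isSimple_periodIso_iff_isPrimitive Ψ I φ₀).1 h)⟩

/-- **A non-simple `ℂ⁵/Φ(𝔞)` for `ℚ(ζ₁₁)` is isogenous to `E⁵`**, `E = ℂ/Φ₀(𝔞₀)` a CM elliptic curve of the imaginary
quadratic subfield (`ℚ(√−11)`) whose type induces `Φ`, for every ideal `𝔞₀`. [cite: Shimura1998, §6.2 Thm. 3 pp. 42–44, §8.4 Example (1) p. 65] -/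
theorem exists_isIsogenous_pow_five_periodIso_eleven (Φ : CMType K) (I : (FractionalIdeal (𝓞 K)⁰ K)ˣ)
    (hns : ¬ ComplexTorus.IsSimple (periodIso Φ I)) :
    ∃ (K₀ : IntermediateField ℚ K) (Φ₀ : CMType K₀),
      finrank ℚ K₀ = 2 ∧ inducedCMType (algebraMap K₀ K) Φ₀ = Φ ∧
      ∀ I₀ : (FractionalIdeal (𝓞 K₀)⁰ K₀)ˣ,
        ComplexTorus.IsSimple (periodIso Φ₀ I₀) ∧ IsIsogenous (periodIso Φ I) (powPeriod (periodIso Φ₀ I₀) 5) :=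
  exists_isIsogenous_pow_of_not_isSimple Nat.prime_five (finrank_eq_ten_of_isCyclotomicExtension_eleven K) Φ I hns

/-- **THE SIMPLE MODELS OF `ℚ(ζ₁₁)` ARE CLASSIFIED BY SHIMURA'S FAMILIES — ALL IDEALS, NO HYPOTHESIS**: for `ℂ⁵/Φ(𝔞)`
simple, `ℂ⁵/Φ(𝔞) ≅ ℂ⁵/Ψ(𝔟)` as complex tori iff `Ψ` is the transform of `Φ` by an automorphism of `ℚ(ζ₁₁)`
(`h(ℚ(ζ₁₁)) = 1` and generation 31's `isIsomorphic_iff_isAutTransform`). [cite: Shimura1998, §7.4 Prop. 17 p. 58, §8.4 Example (1) p. 65]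
[cite: BirkenhakeLange2004, §13.3] [cite: Washington1997, Thm. 11.1] -/
theorem isIsomorphic_periodIso_iff_isAutTransform_eleven {Φ : CMType K} (Ψ : CMType K)
    {I : (FractionalIdeal (𝓞 K)⁰ K)ˣ} (J : (FractionalIdeal (𝓞 K)⁰ K)ˣ) (hΦ : ComplexTorus.IsSimple (periodIso Φ I)) :
    IsIsomorphic (periodIso Φ I) (periodIso Ψ J) ↔ IsAutTransform Φ Ψ := by
  haveI := isPrincipalIdealRing_eleven K
  obtain ⟨ζ, hζ⟩ : ∃ ζ : K, IsPrimitiveRoot ζ 11 :=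
    IsCyclotomicExtension.exists_isPrimitiveRoot ℚ K (Set.mem_singleton 11) (by norm_num)
  exact isIsomorphic_iff_isAutTransform hζ (mulMatrix_toInteger_mem_endRingInt hζ Φ I) (charpoly_mulMatrix_toInteger hζ I)
    (mulMatrix_toInteger_mem_endRingInt hζ Ψ J) (charpoly_mulMatrix_toInteger hζ J) hΦ (AddEquiv.refl _) contMDiff_id
    contMDiff_id (fun _ ↦ rfl) (AddEquiv.refl _) contMDiff_id contMDiff_id (fun _ ↦ rfl)

/-- **THE NON-SIMPLE MODELS OF `ℚ(ζ₁₁)` ARE ONE TORUS**: for `ℂ⁵/Φ(𝔞)` non-simple, `ℂ⁵/Φ(𝔞) ≅ ℂ⁵/Ψ(𝔟)` iff `ℂ⁵/Ψ(𝔟)`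
is non-simple too (the two imprimitive types are one family; `h = 1`). [cite: Shimura1998, §7.4 Prop. 17 p. 58, §8.4 Example (1) p. 65]
[cite: BirkenhakeLange2004, §13.3] -/
theorem isIsomorphic_periodIso_iff_of_not_isSimple_eleven {Φ : CMType K} (Ψ : CMType K) {I : (FractionalIdeal (𝓞 K)⁰ K)ˣ}
    (J : (FractionalIdeal (𝓞 K)⁰ K)ˣ) (hΦ : ¬ ComplexTorus.IsSimple (periodIso Φ I)) :
    IsIsomorphic (periodIso Φ I) (periodIso Ψ J) ↔ ¬ ComplexTorus.IsSimple (periodIso Ψ J) := by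
  refine ⟨fun h hΨ ↦ hΦ (h.isSimple_iff.2 hΨ), fun hΨ ↦ ?_⟩
  haveI := isPrincipalIdealRing_eleven K
  obtain ⟨φ₀⟩ := nonempty_embedding₁₁ (K := K)
  obtain ⟨ζ, hζ⟩ : ∃ ζ : K, IsPrimitiveRoot ζ 11 :=
    IsCyclotomicExtension.exists_isPrimitiveRoot ℚ K (Set.mem_singleton 11) (by norm_num)
  have hfam : IsAutTransform Φ Ψ :=
    (isAutTransform_iff_not_isPrimitive_eleven Ψ φ₀ (fun h ↦ hΦ ((isSimple_periodIso_iff_isPrimitive Φ I φ₀).2 h))).2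
      (fun h ↦ hΨ ((isSimple_periodIso_iff_isPrimitive Ψ J φ₀).2 h))
  exact isIsomorphic_of_isAutTransform hζ (mulMatrix_toInteger_mem_endRingInt hζ Φ I) (charpoly_mulMatrix_toInteger hζ I)
    (mulMatrix_toInteger_mem_endRingInt hζ Ψ J) (charpoly_mulMatrix_toInteger hζ J) (AddEquiv.refl _) contMDiff_id
    (fun _ ↦ rfl) (AddEquiv.refl _) contMDiff_id contMDiff_id (fun _ ↦ rfl) hfam

/-- **FOUR MODELS**: there are CM types `Φ₁, Φ₂, Φ₃, Φ₄` of `ℚ(ζ₁₁)` whose principal models `Xᵢ = ℂ⁵/Φᵢ(𝓞)` are pairwise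
non-isomorphic, `X₁, X₂, X₃` simple (one for each family of primitive types; `Φ₁` is Shimura's `{φ₁, …, φ₅}`) and `X₄`
non-simple, such that EVERY model `ℂ⁵/Φ(𝔞)` is isomorphic to one of them. [cite: Shimura1998, §7.4 Prop. 17 p. 58, §8.4 Example (1) p. 65]
[cite: BirkenhakeLange2004, §13.3] [cite: Washington1997, Thm. 11.1] -/
theorem exists_four_models_eleven :
    ∃ Φ₁ Φ₂ Φ₃ Φ₄ : CMType K,
      ComplexTorus.IsSimple (periodIso Φ₁ (1 : (FractionalIdeal (𝓞 K)⁰ K)ˣ)) ∧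
      ComplexTorus.IsSimple (periodIso Φ₂ (1 : (FractionalIdeal (𝓞 K)⁰ K)ˣ)) ∧
      ComplexTorus.IsSimple (periodIso Φ₃ (1 : (FractionalIdeal (𝓞 K)⁰ K)ˣ)) ∧
      ¬ ComplexTorus.IsSimple (periodIso Φ₄ (1 : (FractionalIdeal (𝓞 K)⁰ K)ˣ)) ∧
      ¬ IsIsomorphic (periodIso Φ₁ (1 : (FractionalIdeal (𝓞 K)⁰ K)ˣ)) (periodIso Φ₂ (1 : (FractionalIdeal (𝓞 K)⁰ K)ˣ)) ∧
      ¬ IsIsomorphic (periodIso Φ₁ (1 : (FractionalIdeal (𝓞 K)⁰ K)ˣ)) (periodIso Φ₃ (1 : (FractionalIdeal (𝓞 K)⁰ K)ˣ)) ∧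
      ¬ IsIsomorphic (periodIso Φ₂ (1 : (FractionalIdeal (𝓞 K)⁰ K)ˣ)) (periodIso Φ₃ (1 : (FractionalIdeal (𝓞 K)⁰ K)ˣ)) ∧
      (∀ i ∈ ({Φ₁, Φ₂, Φ₃} : Set (CMType K)),
        ¬ IsIsomorphic (periodIso i (1 : (FractionalIdeal (𝓞 K)⁰ K)ˣ)) (periodIso Φ₄ (1 : (FractionalIdeal (𝓞 K)⁰ K)ˣ))) ∧
      ∀ (Φ : CMType K) (I : (FractionalIdeal (𝓞 K)⁰ K)ˣ),
        IsIsomorphic (periodIso Φ I) (periodIso Φ₁ (1 : (FractionalIdeal (𝓞 K)⁰ K)ˣ)) ∨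
        IsIsomorphic (periodIso Φ I) (periodIso Φ₂ (1 : (FractionalIdeal (𝓞 K)⁰ K)ˣ)) ∨
        IsIsomorphic (periodIso Φ I) (periodIso Φ₃ (1 : (FractionalIdeal (𝓞 K)⁰ K)ˣ)) ∨
        IsIsomorphic (periodIso Φ I) (periodIso Φ₄ (1 : (FractionalIdeal (𝓞 K)⁰ K)ˣ)) := by
  obtain ⟨φ₀⟩ := nonempty_embedding₁₁ (K := K)
  obtain ⟨Φ₁, Φ₂, Φ₃, -, h₁, h₂, h₃, h₁₂, h₁₃, h₂₃, hall⟩ := exists_three_families_eleven (L := K) φ₀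
  obtain ⟨-, Φ₄, -, h₄⟩ := exists_isSimple_and_not_isSimple_periodIso_eleven (K := K) 1
  have hS₁ := (isSimple_periodIso_iff_isPrimitive Φ₁ (1 : (FractionalIdeal (𝓞 K)⁰ K)ˣ) φ₀).2 h₁
  have hS₂ := (isSimple_periodIso_iff_isPrimitive Φ₂ (1 : (FractionalIdeal (𝓞 K)⁰ K)ˣ) φ₀).2 h₂
  have hS₃ := (isSimple_periodIso_iff_isPrimitive Φ₃ (1 : (FractionalIdeal (𝓞 K)⁰ K)ˣ) φ₀).2 h₃
  refine ⟨Φ₁, Φ₂, Φ₃, Φ₄, hS₁, hS₂, hS₃, h₄,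
    fun h ↦ h₁₂ ((isIsomorphic_periodIso_iff_isAutTransform_eleven Φ₂ 1 hS₁).1 h),
    fun h ↦ h₁₃ ((isIsomorphic_periodIso_iff_isAutTransform_eleven Φ₃ 1 hS₁).1 h),
    fun h ↦ h₂₃ ((isIsomorphic_periodIso_iff_isAutTransform_eleven Φ₃ 1 hS₂).1 h), fun i hi h ↦ ?_, fun Φ I ↦ ?_⟩
  · rcases hi with rfl | rfl | rfl
    · exact h₄ (h.isSimple_iff.1 hS₁)
    · exact h₄ (h.isSimple_iff.1 hS₂)
    · exact h₄ (h.isSimple_iff.1 hS₃)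
  · by_cases hΦ : ComplexTorus.IsSimple (periodIso Φ I)
    · rcases hall Φ ((isSimple_periodIso_iff_isPrimitive Φ I φ₀).1 hΦ) with h | h | h
      · exact Or.inl ((isIsomorphic_periodIso_iff_isAutTransform_eleven Φ₁ 1 hΦ).2 h.symm)
      · exact Or.inr (Or.inl ((isIsomorphic_periodIso_iff_isAutTransform_eleven Φ₂ 1 hΦ).2 h.symm))
      · exact Or.inr (Or.inr (Or.inl ((isIsomorphic_periodIso_iff_isAutTransform_eleven Φ₃ 1 hΦ).2 h.symm)))
    · exact Or.inr (Or.inr (Or.inr ((isIsomorphic_periodIso_iff_of_not_isSimple_eleven Φ₄ 1 hΦ).2 h₄)))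

end Models

/-! ### §2 The pairs `(X, u)`: `5`-dimensional complex tori with an endomorphism of order `11` -/

section Eleven

variable {ι : Type} [Fintype ι] [DecidableEq ι] {E : Type} [NormedAddCommGroup E] [NormedSpace ℂ E]
  {P : (ι → ℝ) ≃L[ℝ] E} {ι' : Type} [Fintype ι'] [DecidableEq ι'] {E' : Type} [NormedAddCommGroup E']
  [NormedSpace ℂ E'] {P' : (ι' → ℝ) ≃L[ℝ] E'}

set_option backward.isDefEq.respectTransparency false in -- Mathlib's instance
-- `IsCyclotomicExtension {11} ℚ (CyclotomicField 11 ℚ)` is keyed on `CyclotomicField.algebra`, the goal on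
-- `DivisionRing.toRatAlgebra` (same workaround as generation 31 FILE 1 `isAbelianVariety_of_charpoly_eq_cyclotomic`)
/-- **A NON-SIMPLE `5`-TORUS WITH AN AUTOMORPHISM OF ORDER `11` IS ISOGENOUS TO `E⁵`**, `E = ℂ/Φ₀(𝔞₀)` a CM elliptic curve
of an imaginary quadratic subfield `K₀ ⊂ ℚ(ζ₁₁)` (`= ℚ(√−11)`), for every ideal `𝔞₀` of `K₀`.
[cite: Shimura1998, §6.1 Thm. 2 p. 41, §6.2 Thm. 3 pp. 42–44, §8.2 Prop. 26 p. 69] [cite: BirkenhakeLange2004, §13.3] -/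
theorem exists_isIsogenous_pow_five_of_orderOf_eq_eleven {A : Matrix ι ι ℤ} (hA : A ∈ endRingInt P)
    (hord : orderOf A = 11) (hdim : finrank ℂ E = 5) (hns : ¬ ComplexTorus.IsSimple P) :
    ∃ (K₀ : IntermediateField ℚ (CyclotomicField 11 ℚ)) (Φ₀ : CMType K₀), finrank ℚ K₀ = 2 ∧
      ∀ I₀ : (FractionalIdeal (𝓞 K₀)⁰ K₀)ˣ,
        ComplexTorus.IsSimple (periodIso Φ₀ I₀) ∧ IsIsogenous P (powPeriod (periodIso Φ₀ I₀) 5) := by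
  have hζ := IsCyclotomicExtension.zeta_spec 11 ℚ (CyclotomicField 11 ℚ)
  obtain ⟨Φ, I, e, he, he₂, -⟩ :=
    exists_cmType_ideal_iso_of_charpoly_eq_cyclotomic hζ hA (charpoly_eq_cyclotomic_eleven_of_orderOf hord hdim P)
  have hns' : ¬ ComplexTorus.IsSimple (periodIso Φ I) := fun h ↦ hns ((IsIsomorphic.isSimple_iff ⟨e, he, he₂⟩).2 h)
  obtain ⟨K₀, Φ₀, h2, -, hI⟩ := exists_isIsogenous_pow_five_periodIso_eleven Φ I hns'
  exact ⟨K₀, Φ₀, h2, fun I₀ ↦ ⟨(hI I₀).1,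
    IsIsogenous.trans _ _ _ (IsIsomorphic.isIsogenous ⟨e, he, he₂⟩) (hI I₀).2⟩⟩

set_option backward.isDefEq.respectTransparency false in -- see above
/-- **ALL NON-SIMPLE `5`-DIMENSIONAL COMPLEX TORI WITH AN ENDOMORPHISM OF ORDER `11` ARE ISOMORPHIC** (their types are the
two imprimitive ones, one family; `h(ℚ(ζ₁₁)) = 1`). [cite: Shimura1998, §7.4 Prop. 17 p. 58, §8.2 Prop. 26 p. 69, §8.4 Example (1) p. 65]
[cite: BirkenhakeLange2004, §13.3] [cite: Washington1997, Thm. 11.1] -/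
theorem isIsomorphic_of_not_isSimple_of_orderOf_eq_eleven (hX : ¬ ComplexTorus.IsSimple P) {A : Matrix ι ι ℤ}
    (hA : A ∈ endRingInt P) (hord : orderOf A = 11) (hdim : finrank ℂ E = 5) (hX' : ¬ ComplexTorus.IsSimple P')
    {A' : Matrix ι' ι' ℤ} (hA' : A' ∈ endRingInt P') (hord' : orderOf A' = 11) (hdim' : finrank ℂ E' = 5) :
    IsIsomorphic P P' := by
  have hζ := IsCyclotomicExtension.zeta_spec 11 ℚ (CyclotomicField 11 ℚ)
  obtain ⟨Φ, I, e, he, he₂, -⟩ :=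
    exists_cmType_ideal_iso_of_charpoly_eq_cyclotomic hζ hA (charpoly_eq_cyclotomic_eleven_of_orderOf hord hdim P)
  obtain ⟨Φ', I', e', he', he₂', -⟩ :=
    exists_cmType_ideal_iso_of_charpoly_eq_cyclotomic hζ hA' (charpoly_eq_cyclotomic_eleven_of_orderOf hord' hdim' P')
  have hS : ¬ ComplexTorus.IsSimple (periodIso Φ I) := fun h ↦ hX ((IsIsomorphic.isSimple_iff ⟨e, he, he₂⟩).2 h)
  have hS' : ¬ ComplexTorus.IsSimple (periodIso Φ' I') := fun h ↦ hX' ((IsIsomorphic.isSimple_iff ⟨e', he', he₂'⟩).2 h)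
  exact (IsIsomorphic.trans ⟨e, he, he₂⟩ ((isIsomorphic_periodIso_iff_of_not_isSimple_eleven Φ' I' hS).2 hS')).trans
    (IsIsomorphic.symm ⟨e', he', he₂'⟩)

set_option backward.isDefEq.respectTransparency false in -- see above
/-- **EXACTLY FOUR COMPLEX TORI OF DIMENSION `5` ADMIT AN AUTOMORPHISM OF ORDER `11`.**  There are CM types `Φ₁, …, Φ₄` of
`ℚ(ζ₁₁)` (Mathlib's `CyclotomicField 11 ℚ`) whose principal models `Xᵢ = ℂ⁵/Φᵢ(𝓞)` — each carrying the automorphism `ζ₁₁`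
of order `11` — are pairwise non-isomorphic, `X₁, X₂, X₃` simple and `X₄` not, such that EVERY `5`-dimensional complex
torus with an endomorphism of order `11` is isomorphic to one of them: `h(ℚ(ζ₁₁)) · #(types mod automorphisms) = 1 · (3 + 1)`.
[cite: Shimura1998, §6.1 Thm. 2 p. 41, §7.4 Prop. 17 p. 58, §8.4 Example (1) p. 65] [cite: BirkenhakeLange2004, §13.3]
[cite: Washington1997, Thm. 11.1] -/
theorem exists_four_forall_isIsomorphic_of_orderOf_eq_eleven :
    ∃ Φ₁ Φ₂ Φ₃ Φ₄ : CMType (CyclotomicField 11 ℚ),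
      ComplexTorus.IsSimple (periodIso Φ₁ (1 : (FractionalIdeal (𝓞 (CyclotomicField 11 ℚ))⁰ (CyclotomicField 11 ℚ))ˣ)) ∧
      ComplexTorus.IsSimple (periodIso Φ₂ (1 : (FractionalIdeal (𝓞 (CyclotomicField 11 ℚ))⁰ (CyclotomicField 11 ℚ))ˣ)) ∧
      ComplexTorus.IsSimple (periodIso Φ₃ (1 : (FractionalIdeal (𝓞 (CyclotomicField 11 ℚ))⁰ (CyclotomicField 11 ℚ))ˣ)) ∧
      ¬ ComplexTorus.IsSimple (periodIso Φ₄ (1 : (FractionalIdeal (𝓞 (CyclotomicField 11 ℚ))⁰ (CyclotomicField 11 ℚ))ˣ)) ∧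
      ¬ IsIsomorphic (periodIso Φ₁ (1 : (FractionalIdeal (𝓞 (CyclotomicField 11 ℚ))⁰ (CyclotomicField 11 ℚ))ˣ))
          (periodIso Φ₂ (1 : (FractionalIdeal (𝓞 (CyclotomicField 11 ℚ))⁰ (CyclotomicField 11 ℚ))ˣ)) ∧
      ¬ IsIsomorphic (periodIso Φ₁ (1 : (FractionalIdeal (𝓞 (CyclotomicField 11 ℚ))⁰ (CyclotomicField 11 ℚ))ˣ))
          (periodIso Φ₃ (1 : (FractionalIdeal (𝓞 (CyclotomicField 11 ℚ))⁰ (CyclotomicField 11 ℚ))ˣ)) ∧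
      ¬ IsIsomorphic (periodIso Φ₂ (1 : (FractionalIdeal (𝓞 (CyclotomicField 11 ℚ))⁰ (CyclotomicField 11 ℚ))ˣ))
          (periodIso Φ₃ (1 : (FractionalIdeal (𝓞 (CyclotomicField 11 ℚ))⁰ (CyclotomicField 11 ℚ))ˣ)) ∧
      (∀ i ∈ ({Φ₁, Φ₂, Φ₃} : Set (CMType (CyclotomicField 11 ℚ))),
        ¬ IsIsomorphic (periodIso i (1 : (FractionalIdeal (𝓞 (CyclotomicField 11 ℚ))⁰ (CyclotomicField 11 ℚ))ˣ))
          (periodIso Φ₄ (1 : (FractionalIdeal (𝓞 (CyclotomicField 11 ℚ))⁰ (CyclotomicField 11 ℚ))ˣ))) ∧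
      ∀ {ι : Type} [Fintype ι] [DecidableEq ι] {E : Type} [NormedAddCommGroup E] [NormedSpace ℂ E]
        (P : (ι → ℝ) ≃L[ℝ] E) {A : Matrix ι ι ℤ}, A ∈ endRingInt P → orderOf A = 11 → finrank ℂ E = 5 →
        IsIsomorphic P (periodIso Φ₁ (1 : (FractionalIdeal (𝓞 (CyclotomicField 11 ℚ))⁰ (CyclotomicField 11 ℚ))ˣ)) ∨
        IsIsomorphic P (periodIso Φ₂ (1 : (FractionalIdeal (𝓞 (CyclotomicField 11 ℚ))⁰ (CyclotomicField 11 ℚ))ˣ)) ∨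
        IsIsomorphic P (periodIso Φ₃ (1 : (FractionalIdeal (𝓞 (CyclotomicField 11 ℚ))⁰ (CyclotomicField 11 ℚ))ˣ)) ∨
        IsIsomorphic P (periodIso Φ₄ (1 : (FractionalIdeal (𝓞 (CyclotomicField 11 ℚ))⁰ (CyclotomicField 11 ℚ))ˣ)) := by
  have hζ := IsCyclotomicExtension.zeta_spec 11 ℚ (CyclotomicField 11 ℚ)
  obtain ⟨Φ₁, Φ₂, Φ₃, Φ₄, h₁, h₂, h₃, h₄, h₁₂, h₁₃, h₂₃, hi4, hall⟩ := exists_four_models_eleven (K := CyclotomicField 11 ℚ)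
  refine ⟨Φ₁, Φ₂, Φ₃, Φ₄, h₁, h₂, h₃, h₄, h₁₂, h₁₃, h₂₃, hi4, fun P A hA hord hdim ↦ ?_⟩
  obtain ⟨Φ, I, e, he, he₂, -⟩ :=
    exists_cmType_ideal_iso_of_charpoly_eq_cyclotomic hζ hA (charpoly_eq_cyclotomic_eleven_of_orderOf hord hdim P)
  have hX : IsIsomorphic P (periodIso Φ I) := ⟨e, he, he₂⟩
  rcases hall Φ I with h | h | h | h
  · exact Or.inl (hX.trans h)
  · exact Or.inr (Or.inl (hX.trans h))
  · exact Or.inr (Or.inr (Or.inl (hX.trans h)))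
  · exact Or.inr (Or.inr (Or.inr (hX.trans h)))

set_option backward.isDefEq.respectTransparency false in -- see above
/-- **THE HODGE CLASSES ON EVERY POWER OF EVERY `5`-DIMENSIONAL COMPLEX TORUS WITH AN ENDOMORPHISM OF ORDER `11` ARE
GENERATED BY DIVISOR CLASSES**: `Hdg(X^k) = Div(X^k)` for all `k`.  Simple `X`: prime dimension `5` (generation 32 FILE 8).
Non-simple `X`: `X ∼ E⁵` with `E = ℂ/Φ₀(𝓞_{K₀})` a CM elliptic curve; «`Hdg = Div` on all powers» is an isogeny invariant
passing between `E` and `E⁵`, and holds for `E` (simple, of CM-type, `dim ≤ 3`).  No instance hypothesis.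
[cite: MoonenZarhin1999LowDim, Thm. 0.1 (4) and (0.2)(4)] [cite: Gordon1999HodgeAVSurvey, Thm. 6.3 (2) and Remark, 7.6]
[cite: BirkenhakeLange2004, §13.3] -/
theorem divisorClasses_powPeriod_eq_hodgeClasses_of_orderOf_eq_eleven {A : Matrix ι ι ℤ} (hA : A ∈ endRingInt P)
    (hord : orderOf A = 11) (hdim : finrank ℂ E = 5) (k p : ℕ) :
    divisorClasses (powPeriod P k) p = hodgeClasses (powPeriod P k) p := by
  by_cases hX : ComplexTorus.IsSimple P
  · exact hX.divisorClasses_powPeriod_eq_hodgeClasses_of_orderOf_eq_eleven hA hord hdim k p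
  · haveI : HodgeTensorFacts.{0, 0} := hodgeTensorFacts_holds.{0, 0}
    obtain ⟨K₀, Φ₀, h2, hI⟩ := exists_isIsogenous_pow_five_of_orderOf_eq_eleven hA hord hdim hX
    obtain ⟨hS₀, hiso⟩ := hI 1
    haveI : IsTotallyComplex K₀ := isTotallyComplex_of_cmType Φ₀
    haveI : Algebra.IsQuadraticExtension ℚ K₀ := { finrank_eq_two' := h2 }
    haveI : IsCMField K₀ := IsCMField.ofCMExtension ℚ K₀
    have hY : IsAbelianVariety (periodIso Φ₀ 1) := isAbelianVariety_periodIso Φ₀ 1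
    have hcard : Fintype.card (basisIndex (1 : (FractionalIdeal (𝓞 K₀)⁰ K₀)ˣ)) = 2 := by
      rw [card_basisIndex_eq_finrank, h2]
    haveI : Nonempty (basisIndex (1 : (FractionalIdeal (𝓞 K₀)⁰ K₀)ˣ)) := Fintype.card_pos_iff.1 (by omega)
    exact (forall_powPeriod_divisorClasses_eq_hodgeClasses_iff_of_isIsogenous_powPeriod hY (by norm_num) hiso).2
      (fun k p ↦ hY.divisorClasses_powPeriod_eq_hodgeClasses_of_isSimple_of_card_le_six_of_isTorusSubgroup_mumfordTateGroupC
        hS₀ (isTorusSubgroup_mumfordTateGroupC_periodIso Φ₀ 1) (by omega) k p) k p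

/-! ### §3 Orders `11` and `22` together -/

/-- An endomorphism of order `11` or `22` of a `5`-torus yields one of order `11` (`u` itself or `−u`, FILE 8).
[cite: BirkenhakeLange2004, §13.3] -/
theorem exists_orderOf_eq_eleven_of_orderOf_eq_eleven_or_twentytwo {A : Matrix ι ι ℤ} (hA : A ∈ endRingInt P)
    (hord : orderOf A = 11 ∨ orderOf A = 22) (hdim : finrank ℂ E = 5) :
    ∃ B : Matrix ι ι ℤ, B ∈ endRingInt P ∧ orderOf B = 11 := by
  rcases hord with h | h
  · exact ⟨A, hA, h⟩
  · exact ⟨-A, Subring.neg_mem _ hA, orderOf_neg_eq_eleven_of_orderOf_eq_twentytwo hA h hdim⟩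

/-- **All non-simple `5`-dimensional complex tori with an automorphism of order `11` or `22` are isomorphic.**
[cite: Shimura1998, §7.4 Prop. 17 p. 58, §8.4 Example (1) p. 65] [cite: BirkenhakeLange2004, §13.3] -/
theorem isIsomorphic_of_not_isSimple_of_orderOf_eq_eleven_or_twentytwo (hX : ¬ ComplexTorus.IsSimple P)
    {A : Matrix ι ι ℤ} (hA : A ∈ endRingInt P) (hord : orderOf A = 11 ∨ orderOf A = 22) (hdim : finrank ℂ E = 5)
    (hX' : ¬ ComplexTorus.IsSimple P') {A' : Matrix ι' ι' ℤ} (hA' : A' ∈ endRingInt P')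
    (hord' : orderOf A' = 11 ∨ orderOf A' = 22) (hdim' : finrank ℂ E' = 5) : IsIsomorphic P P' := by
  obtain ⟨B, hB, hB11⟩ := exists_orderOf_eq_eleven_of_orderOf_eq_eleven_or_twentytwo hA hord hdim
  obtain ⟨B', hB', hB11'⟩ := exists_orderOf_eq_eleven_of_orderOf_eq_eleven_or_twentytwo hA' hord' hdim'
  exact isIsomorphic_of_not_isSimple_of_orderOf_eq_eleven hX hB hB11 hdim hX' hB' hB11' hdim'

/-- **`Hdg(X^k) = Div(X^k)` for all `k` for every `5`-dimensional complex torus with an endomorphism of order `11` or `22`.**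
[cite: MoonenZarhin1999LowDim, Thm. 0.1 (4)] [cite: Gordon1999HodgeAVSurvey, Thm. 6.3 (2) and Remark, 7.6] -/
theorem divisorClasses_powPeriod_eq_hodgeClasses_of_orderOf_eq_eleven_or_twentytwo {A : Matrix ι ι ℤ}
    (hA : A ∈ endRingInt P) (hord : orderOf A = 11 ∨ orderOf A = 22) (hdim : finrank ℂ E = 5) (k p : ℕ) :
    divisorClasses (powPeriod P k) p = hodgeClasses (powPeriod P k) p := by
  obtain ⟨B, hB, hB11⟩ := exists_orderOf_eq_eleven_of_orderOf_eq_eleven_or_twentytwo hA hord hdim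
  exact divisorClasses_powPeriod_eq_hodgeClasses_of_orderOf_eq_eleven hB hB11 hdim k p

end Eleven

end ComplexTorus

end Literature.Geometry.Kaehler

end
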